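import Summits.CriticalPhenomena.PercolationContinuityZ3.Theorems.SahiMasterFamilyTotalCumulance
import Summits.CriticalPhenomena.PercolationContinuityZ3.Theorems.PercNearOneGluingNoHeavyLowerTailSahiMixtureGenericCellThree
import Summits.CriticalPhenomena.PercolationContinuityZ3.Theorems.PercNearOneGluingNoHeavyLowerTailSahiMixtureHereditary

/-!
# Every OR-mixture cell is an outer COIN functional of two-point block functions whose values are hereditary rows
# (the law of total cumulance, conditioned on the coin)

Support file of the one-cut programme (crux `NoHeavyLowerTail`, stmt-CriticalPhenomena-4575; cell `prim-masterthm`, seat P3, gen 10;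
`run/shared/lean/prim/prim-masterthm/prim-masterthm-p3/HIERARCHY.md` §18(j)).  Seat P4's law of total cumulance for Sahi's `E_n`
(`SahiTotalCumulance.sahiE_prod_eq_sum_partition`, ANY functions on a product weight) specialised to the coin space `α × Bool` with the weight
`coinWeight μ h = μ ⊗ coin(h)` and to the members `⋂_{i∈K_j}(A_i ∪ [F i]·H)` of the ∩-closed family of OR-mixed events:

  `E_{m+1}(μ ⊗ coin(h); (1_{⋂_{i∈K_j}(A_i ∪ [F i]H)})_j) = Σ_{π ∈ Part({0,…,m})} E^{coin(h)}_{|π|}( g_B : B ∈ π )`,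
  `g_B(ξ) = rowOn_B = E^μ_{|B|}(1_{A_{K_j}} : j ∈ B)` off the coin (`ξ = false`), `g_B(ξ) = rowOff_B = E^μ_{|B|}(1_{A_{K_j ∖ F}} : j ∈ B)` on the coin

(`sahiE_orCoin_eq_sum_partition`; the conditional inner functional of a block is the hereditary ROW with the coin's members present / deleted,
`condE_orCoin`).  So on the hereditary class `𝒦_n` (`HereditaryAllOrders`) every OR cell — for every `n`, every `F`, every slot map — is a sum over set
partitions of coin functionals of NONNEGATIVE two-point functions (`rowOn_nonneg`, `rowOff_nonneg`).  This is the OR counterpart of the mechanism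
behind the AND-mixture theorem (`…SahiMixtureAnd`: there the block functions are `c·1_H` or constants, whose coin functionals are Bernstein-positive,
ALL SIGNS PLUS); for OR the two-point functions `a·1_{Hᶜ} + b·1_H` have mixed monotonicity (`b ≥ a` for singleton blocks, since moments shrink when
members are inserted, but e.g. `b = 0 ≤ a` for the non-singleton blocks of TOP cells), and `E^{coin}_r` of functions of mixed monotonicity has signs
(`E_2(1_{Hᶜ}, 1_H) = −h(1−h)`): the exact locus of the difficulty of H-MIX, and the natural coordinates (products of rows over the blocks of a
partition — each liftable to the comb level with additive degrees) for certificates of the surviving cells (HIERARCHY §18(h),(j)).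
* `sahiE_two_orCoin_cell_eq` — the order-2 instance in closed form: `(1−h)·rowOn_{01} + h·rowOff_{01} + h(1−h)(m′_0 − m_0)(m′_1 − m_1)` with
  `m_j = μ(A_{K_j}) ≤ m′_j = μ(A_{K_j∖F})` (all three terms `≥ 0` on `𝒦_n`: the known order-2 cell `bernsteinPos_two_mixEv` of `…SahiMixtureHMixFour`, read
  through the partition sum — `π = {01}` gives the first two terms, `π = {0}{1}` the third).
HONEST FRAMING: an identity (bookkeeping for the OR programme); H-MIX(n) is false for `n ≥ 5` and nothing here claims otherwise; nothing about Sahi's `C_k`. [this work]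
-/

noncomputable section

open scoped Classical

namespace Summit.CriticalPhenomena.PercolationContinuityZ3.Theorems

open Finset Function
open Literature.Combinatorics.Sahi2008
open Literature.Combinatorics.Sahi2008.PartitionForm
open Literature.Probability.Percolation.DecisionTree (ind ind_of_mem ind_of_not_mem ind_nonneg)

namespace SahiMixture

variable {α : Type*} [Fintype α]

/-! ### The coin law and the two rows of a block -/

/-- The law of a coin of bias `h` on `Bool`. [folklore] -/
def coinLaw (h : ℝ) : Bool → ℝ := fun ξ => bif ξ then h else 1 - h

omit [Fintype α] in
/-- `coinWeight μ h` is the product weight `μ ⊗ coinLaw h`. [this work] -/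
theorem coinWeight_eq_prod (μ : α → ℝ) (h : ℝ) : coinWeight μ h = fun p : α × Bool => μ p.1 * coinLaw h p.2 := rfl

variable (μ : α → ℝ) {n N : ℕ} (A : Fin n → Set α) (F : Fin n → Bool) (K : Fin N → Finset (Fin n))

/-- The hereditary row of the block `S` with the coin's members PRESENT: `E^μ_{|S|}(1_{A_{K_j}} : j ∈ S)` (increasing enumeration of `S`). [this work] -/
def rowOn (S : Finset (Fin N)) : ℝ :=
  sahiE μ S.card (fun j => ind (⋂ i ∈ K (S.orderEmbOfFin rfl j), A i))

/-- The hereditary row of the block `S` with the coin's members DELETED: `E^μ_{|S|}(1_{A_{K_j ∖ F}} : j ∈ S)`. [this work] -/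
def rowOff (S : Finset (Fin N)) : ℝ :=
  sahiE μ S.card (fun j => ind (⋂ i ∈ (K (S.orderEmbOfFin rfl j)).filter (fun i => F i = false), A i))

/-- **The conditional inner functional of a block of OR-mixed members is the two-point function `(rowOn, rowOff)`.** [this work] -/
theorem condE_orCoin (S : Finset (Fin N)) :
    SahiTotalCumulance.condE μ (fun j (p : α × Bool) => ind (⋂ i ∈ K j, orCoin (A i) (F i)) p) S
      = fun ξ => bif ξ then rowOff μ A F K S else rowOn μ A K S := by
  funext ξ
  unfold SahiTotalCumulance.condE SahiTotalCumulance.secFam rowOn rowOff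
  cases ξ
  · simp only [cond_false]
    congr 1
    funext j x
    rw [biInter_orCoin_eq_mixEv, ind_mixEv_false]
  · simp only [cond_true]
    congr 1
    funext j x
    rw [biInter_orCoin_eq_mixEv, ind_mixEv_true]

/-! ### The identity -/

/-- **OR cells through the law of total cumulance.**  For ANY weight `μ`, events `A`, pattern `F`, slot map `K` and bias `h`:
`E_{m+1}(μ⊗coin(h); (1_{⋂_{i∈K_j}(A_i ∪ [F i]H)})_j) = Σ_π E^{coin(h)}_{|π|}((ξ ↦ [ξ] ? rowOff_B : rowOn_B)_{B∈π})`. [this work] -/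
theorem sahiE_orCoin_eq_sum_partition (h : ℝ) {m : ℕ} (K : Fin (m + 1) → Finset (Fin n)) :
    sahiE (coinWeight μ h) (m + 1) (fun j => ind (⋂ i ∈ K j, orCoin (A i) (F i)))
      = ∑ c : OrderedFinpartition (m + 1),
          sahiE (coinLaw h) c.length (fun b ξ => bif ξ then rowOff μ A F K (block c b) else rowOn μ A K (block c b)) := by
  rw [coinWeight_eq_prod, SahiTotalCumulance.sahiE_prod_eq_sum_partition μ (coinLaw h) m
    (fun j (p : α × Bool) => ind (⋂ i ∈ K j, orCoin (A i) (F i)) p)]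
  refine Finset.sum_congr rfl fun c _ => ?_
  unfold SahiTotalCumulance.termT
  congr 1
  funext b
  rw [condE_orCoin]

/-! ### On the hereditary class both values of every block function are nonnegative -/

variable {μ A}

/-- `rowOn` is a row of the ∩-closed family, hence `≥ 0` on `𝒦_n`. [this work] -/
theorem rowOn_nonneg (hA : HereditaryAllOrders μ A) (S : Finset (Fin N)) : 0 ≤ rowOn μ A K S :=
  hA S.card (fun j => K (S.orderEmbOfFin rfl j))

/-- `rowOff` is a row of the ∩-closed family, hence `≥ 0` on `𝒦_n`. [this work] -/
theorem rowOff_nonneg (hA : HereditaryAllOrders μ A) (S : Finset (Fin N)) : 0 ≤ rowOff μ A F K S :=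
  hA S.card (fun j => (K (S.orderEmbOfFin rfl j)).filter (fun i => F i = false))

/-! ### The order-2 cell in closed form; every order-2 OR cell is Bernstein-positive on `𝒦_n` -/

variable (μ A)

/-- **The order-2 OR cell in closed form**: with `m_j = μ(A_{K_j})`, `m′_j = μ(A_{K_j∖F})`,
`E_2(μ⊗coin(h); B_{K_0}, B_{K_1}) = (1−h)·Cov(A_{K_0},A_{K_1}) + h·Cov(A_{K_0∖F},A_{K_1∖F}) + h(1−h)(m′_0 − m_0)(m′_1 − m_1)` — the `π = {01}` and
`π = {0}{1}` terms of `sahiE_orCoin_eq_sum_partition` (`E^{coin}_2` of two increasing two-point functions is `h(1−h)·Δ_0Δ_1`). [this work] -/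
theorem sahiE_two_orCoin_cell_eq (h : ℝ) (K : Fin 2 → Finset (Fin n)) :
    sahiE (coinWeight μ h) 2 (fun j => ind (⋂ i ∈ K j, orCoin (A i) (F i)))
      = (1 - h) * sahiE μ 2 ![ind (⋂ i ∈ K 0, A i), ind (⋂ i ∈ K 1, A i)]
        + h * sahiE μ 2 ![ind (⋂ i ∈ (K 0).filter (fun i => F i = false), A i), ind (⋂ i ∈ (K 1).filter (fun i => F i = false), A i)]
        + h * (1 - h)
          * (ex μ (ind (⋂ i ∈ (K 0).filter (fun i => F i = false), A i)) - ex μ (ind (⋂ i ∈ K 0, A i)))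
          * (ex μ (ind (⋂ i ∈ (K 1).filter (fun i => F i = false), A i)) - ex μ (ind (⋂ i ∈ K 1, A i))) := by
  rw [sahiE_two_apply, sahiE_two, sahiE_two]
  simp only [biInter_orCoin_eq_mixEv, exm₂ μ h, exm₁ μ h]
  ring

end SahiMixture

end Summit.CriticalPhenomena.PercolationContinuityZ3.Theorems

end
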